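import Summits.HodgeConjecture.HodgeConjecture.Theses.CrLinkCycles
import Literature.AlgebraicGeometry.HodgeTheory.HypersurfaceComplexPoints

/-!
# Route `CrLinkCycles` — support item `LinkProjectionExists` (stmt-HodgeConjecture-3353)

CONSTRUCTION of the posited interface `π` of the route: for a closed immersion `ι : X ⟶ ℙ^N_ℂ` and
the link `L = {v ∈ ℂ^{N+1} : Σ|v_i|² = 1, [v] ∈ ι(X(ℂ))}` there is a continuous
`π : L → X(ℂ)` with `ι(π v) = [v]` (as complex points of `ℙ^N_ℂ`, through the comparison
homeomorphism `projPoint`).  Proof: `ι(ℂ) : X(ℂ) → ℙ^N(ℂ)` is a topological embedding for a closed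
immersion (`Motives.AlgPoints.isEmbedding_map_of_isClosedImmersion`), hence a homeomorphism onto its
range; `v ↦ [v]` is continuous on `{v ≠ 0}` (`Projectivization.continuous_mk'`) and `projPoint` is
continuous (`isHomeomorph_projPoint`); every `v ∈ L` is non-zero and lands in the range by
definition of `L`.  No definition, no named-fact hypothesis, no sorry.
-/

set_option linter.dupNamespace false

noncomputable section

namespace Summit.HodgeConjecture.HodgeConjecture.Theorems

open Topology Literature.AlgebraicGeometry.Motives Literature.NumberTheory.Transcendental

/-- **Item stmt-HodgeConjecture-3353 (`LinkProjectionExists`, route `CrLinkCycles`)**: for every closed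
immersion `ι : X → ℙ^N_ℂ` and the link `L` of the affine cone over `ι(X)` there is a continuous
`π : L → X(ℂ)` with `AlgPoints.map ι (π v) = projPoint N [v]` — the inverse of the embedding
`ι(ℂ)` on its range composed with `v ↦ projPoint N [v]`.  The type is literally the route decl
`Summit.HodgeConjecture.HodgeConjecture.Theses.CrLinkCycles.LinkProjectionExists`.
[cite: SerreGAGA1956, §2 n°5 Lemme 1 b) and Prop. 2] -/
theorem crLinkCycles_linkProjectionExists_proof :
    Summit.HodgeConjecture.HodgeConjecture.Theses.CrLinkCycles.LinkProjectionExists := by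
  unfold Summit.HodgeConjecture.HodgeConjecture.Theses.CrLinkCycles.LinkProjectionExists
  intro N n X _ ι _ L hL
  -- `ι(ℂ)` is an embedding, hence a homeomorphism onto its range
  have hE : IsEmbedding (AlgPoints.map ι : ComplexPoints X → ComplexPoints (projectiveSpace N ℂ)) :=
    AlgPoints.isEmbedding_map_of_isClosedImmersion ι
  -- every point of the link is non-zero and maps into the range of `ι(ℂ)`
  have hne : ∀ v : L, (v : Fin (N + 1) → ℂ) ≠ 0 := fun v =>
    ((hL v).1 v.2).2.choose
  have hmem : ∀ v : L, projPoint N (Projectivization.mk ℂ (v : Fin (N + 1) → ℂ) (hne v)) ∈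
      Set.range (AlgPoints.map ι) := fun v =>
    ((hL v).1 v.2).2.choose_spec
  -- the map `v ↦ projPoint N [v]` into the range, continuous
  let q : L → Set.range (AlgPoints.map ι : ComplexPoints X → ComplexPoints (projectiveSpace N ℂ)) :=
    fun v => ⟨projPoint N (Projectivization.mk ℂ (v : Fin (N + 1) → ℂ) (hne v)), hmem v⟩
  have hq : Continuous q := by
    refine Continuous.subtype_mk ?_ _
    have h1 : Continuous fun v : L => (⟨(v : Fin (N + 1) → ℂ), hne v⟩ : {w : (Fin (N + 1) → ℂ) // w ≠ 0}) :=
      continuous_subtype_val.subtype_mk _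
    exact (isHomeomorph_projPoint N).continuous.comp (Projectivization.continuous_mk'.comp h1)
  refine ⟨⟨fun v => hE.toHomeomorph.symm (q v), hE.toHomeomorph.symm.continuous.comp hq⟩,
    fun v hv => ?_⟩
  -- `ι(π v) = projPoint N [v]`
  have happ : (AlgPoints.map ι) (hE.toHomeomorph.symm (q v)) = (q v : ComplexPoints (projectiveSpace N ℂ)) := by
    have h := congrArg Subtype.val (hE.toHomeomorph.apply_symm_apply (q v))
    rwa [IsEmbedding.toHomeomorph_apply_coe] at h
  exact happ

end Summit.HodgeConjecture.HodgeConjecture.Theorems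

end
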